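import Mathlib
import HarnessLib

/-!
# Crux `EulerZoomLiouville.PowerGaugeEulerLiouville` (stmt-NavierStokesRegularity-19832), width sub-line `chiral_anchor` (ns-idea-11 g10):
# stub K3 `stub_farVolume` — part (a): THE `C¹` RADIAL CLAMP AND THE PER-LABEL TRAVEL BOUND

Seat ns-ezl-w1 g9 (`--supports stmt-NavierStokesRegularity-19832 --as helper`; LEAD 19832 ns-typeII-p2 g16's key W1-K23, 2026-08-29 10:19Z).
The sub-line `Cruxes/PowerGaugeEulerLiouville/Lines/chiral_anchor.lean` PROVES its stub K3 (`FarVolumeBound`) in-file (REV3, `K3.farVolumeBound_holds`,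
author ns-idea-11 g10); a Cruxes workfile is not importable by `Theorems/`, so the proof is PORTED verbatim (credit: ns-idea-11 g10) in two files.
This is the first: the helper calculus of the Lagrangian clamp functional (line file `namespace K3`, §U1–U2):

* `K3.slope`, `K3.prof`, `K3.clamp`, `K3.clampDeriv` — the slope profile (continuous, values in `[0,1]`, `0` off `(R₀,R)`, `1` on `[R₀+δ,R−δ]`),
  its primitive `g`, the radial clamp `φ(x) = g(‖x‖)` and its derivative; `g ≡ 0` on `B_{R₀}`, `g` constant beyond `R`, `g(R) ≥ (R−R₀)/2`
  (`prof_R_ge`), `‖Dφ‖ ≤ slope(‖·‖)` (`norm_clampDeriv_le`);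
* `K3.label_bound` — along a trajectory `σ ↦ X σ y` with velocity `u σ (X σ y)` within `[t₁,t₀]`, the clamp drops between `s` and `t₀` by at most
  `∫_s^{t₀} slope(‖X σ y‖)‖u σ (X σ y)‖ dσ` (fencing lemma `image_norm_le_of_norm_deriv_right_le_deriv_boundary`).

The assembly (`ChiralAnchor.farVolumeBound`) is `…ChiralAnchorFarVolume.lean`.
HONEST FRAMING: elementary calculus for a width sub-line of the MODEL-lattice crux class; nothing about the crux E (19832 OPEN) or NS regularity; not E.
-/

noncomputable section

-- flat `Theorems/<Route><Decl>…` files of one crux share the namespace of the crux (tree convention)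
set_option linter.dupNamespace false

open MeasureTheory Set Filter Topology Metric
open scoped ENNReal NNReal ContDiff

namespace Summit.NavierStokesRegularity.NavierStokesRegularity.Theorems.PowerGaugeEulerLiouville.ChiralAnchor

namespace K3

/-! ### U1: the `C¹` radial clamp -/

/-- Slope profile: continuous, values in `[0,1]`, vanishing off `(R₀, R)`, equal to `1` on `[R₀+δ, R−δ]`. -/
def slope (R₀ R δ : ℝ) (r : ℝ) : ℝ :=
  max 0 (min 1 (min ((r - R₀) / δ) ((R - r) / δ)))

/-- The slope profile is continuous. [folklore] -/
theorem slope_continuous (R₀ R δ : ℝ) : Continuous (slope R₀ R δ) := by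
  unfold slope
  exact continuous_const.max (continuous_const.min
    (((continuous_id.sub continuous_const).div_const _).min ((continuous_const.sub continuous_id).div_const _)))

/-- The slope profile is nonnegative. [folklore] -/
theorem slope_nonneg (R₀ R δ r : ℝ) : 0 ≤ slope R₀ R δ r := le_max_left _ _

/-- The slope profile is at most `1`. [folklore] -/
theorem slope_le_one (R₀ R δ r : ℝ) : slope R₀ R δ r ≤ 1 := max_le zero_le_one (min_le_left _ _)

/-- The slope profile vanishes on `(-∞, R₀]`. [folklore] -/
theorem slope_eq_zero_of_le {R₀ R δ r : ℝ} (hδ : 0 < δ) (hr : r ≤ R₀) : slope R₀ R δ r = 0 := by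
  unfold slope
  apply max_eq_left
  calc min 1 (min ((r - R₀) / δ) ((R - r) / δ)) ≤ (r - R₀) / δ := (min_le_right _ _).trans (min_le_left _ _)
    _ ≤ 0 := div_nonpos_iff.2 (Or.inr ⟨by linarith, hδ.le⟩)

/-- The slope profile vanishes on `[R, ∞)`. [folklore] -/
theorem slope_eq_zero_of_ge {R₀ R δ r : ℝ} (hδ : 0 < δ) (hr : R ≤ r) : slope R₀ R δ r = 0 := by
  unfold slope
  apply max_eq_left
  calc min 1 (min ((r - R₀) / δ) ((R - r) / δ)) ≤ (R - r) / δ := (min_le_right _ _).trans (min_le_right _ _)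
    _ ≤ 0 := div_nonpos_iff.2 (Or.inr ⟨by linarith, hδ.le⟩)

/-- The slope profile equals `1` on `[R₀+δ, R−δ]`. [folklore] -/
theorem slope_eq_one_of_mem {R₀ R δ r : ℝ} (hδ : 0 < δ) (h1 : R₀ + δ ≤ r) (h2 : r ≤ R - δ) :
    slope R₀ R δ r = 1 := by
  unfold slope
  have hmin : 1 ≤ min ((r - R₀) / δ) ((R - r) / δ) :=
    le_min ((le_div_iff₀ hδ).2 (by linarith)) ((le_div_iff₀ hδ).2 (by linarith))
  rw [min_eq_left hmin, max_eq_right zero_le_one]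

/-- The clamp profile `g(r) = ∫₀ʳ slope`. -/
def prof (R₀ R δ : ℝ) (r : ℝ) : ℝ := ∫ x in (0 : ℝ)..r, slope R₀ R δ x

/-- The clamp profile has derivative the slope profile (FTC). [folklore] -/
theorem prof_hasDerivAt (R₀ R δ r : ℝ) : HasDerivAt (prof R₀ R δ) (slope R₀ R δ r) r :=
  ((slope_continuous R₀ R δ).integral_hasStrictDerivAt 0 r).hasDerivAt

/-- The clamp profile is continuous. [folklore] -/
theorem prof_continuous (R₀ R δ : ℝ) : Continuous (prof R₀ R δ) :=
  continuous_iff_continuousAt.2 fun r => (prof_hasDerivAt R₀ R δ r).continuousAt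

/-- The clamp profile vanishes on `(-∞, R₀]` (`R₀ ≥ 0`). [folklore] -/
theorem prof_eq_zero_of_le {R₀ R δ r : ℝ} (hR₀ : 0 ≤ R₀) (hδ : 0 < δ) (hr : r ≤ R₀) : prof R₀ R δ r = 0 := by
  unfold prof
  rw [intervalIntegral.integral_congr (g := fun _ => (0 : ℝ)) ?_, intervalIntegral.integral_zero]
  intro x hx
  have hx' : x ≤ R₀ := by
    rcases le_total 0 r with h | h
    · rw [uIcc_of_le h] at hx; exact hx.2.trans hr
    · rw [uIcc_of_ge h] at hx; exact hx.2.trans hR₀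
  exact slope_eq_zero_of_le hδ hx'

/-- The clamp profile is constant beyond `R`. [folklore] -/
theorem prof_eq_of_ge {R₀ R δ r : ℝ} (hδ : 0 < δ) (hr : R ≤ r) : prof R₀ R δ r = prof R₀ R δ R := by
  unfold prof
  have hi : ∀ a b : ℝ, IntervalIntegrable (slope R₀ R δ) volume a b := fun a b =>
    (slope_continuous R₀ R δ).intervalIntegrable a b
  rw [← intervalIntegral.integral_add_adjacent_intervals (hi 0 R) (hi R r)]
  have h0 : ∫ x in R..r, slope R₀ R δ x = 0 := by
    rw [intervalIntegral.integral_congr (g := fun _ => (0 : ℝ)) ?_, intervalIntegral.integral_zero]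
    intro x hx
    rw [uIcc_of_le hr] at hx
    exact slope_eq_zero_of_ge hδ hx.1
  rw [h0, add_zero]

/-- The clamp profile reaches at least `(R − R₀)/2` at `R` when `δ = (R − R₀)/4`, `R ≥ 2R₀`. [folklore] -/
theorem prof_R_ge {R₀ R δ : ℝ} (hR₀ : 0 < R₀) (hR : 2 * R₀ ≤ R) (hδ : δ = (R - R₀) / 4) :
    (R - R₀) / 2 ≤ prof R₀ R δ R := by
  have hδ0 : 0 < δ := by rw [hδ]; linarith
  have hi : ∀ a b : ℝ, IntervalIntegrable (slope R₀ R δ) volume a b := fun a b =>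
    (slope_continuous R₀ R δ).intervalIntegrable a b
  unfold prof
  rw [← intervalIntegral.integral_add_adjacent_intervals (hi 0 (R₀ + δ)) (hi (R₀ + δ) R),
    ← intervalIntegral.integral_add_adjacent_intervals (hi (R₀ + δ) (R - δ)) (hi (R - δ) R)]
  have h1 : 0 ≤ ∫ x in (0 : ℝ)..(R₀ + δ), slope R₀ R δ x :=
    intervalIntegral.integral_nonneg (by linarith) fun x _ => slope_nonneg _ _ _ _
  have h3 : 0 ≤ ∫ x in (R - δ)..R, slope R₀ R δ x :=
    intervalIntegral.integral_nonneg (by linarith) fun x _ => slope_nonneg _ _ _ _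
  have h2 : ∫ x in (R₀ + δ)..(R - δ), slope R₀ R δ x = (R - R₀) / 2 := by
    rw [intervalIntegral.integral_congr (g := fun _ => (1 : ℝ)) ?_, intervalIntegral.integral_const, smul_eq_mul,
      mul_one, hδ]
    · ring
    · intro x hx
      rw [uIcc_of_le (by linarith)] at hx
      exact slope_eq_one_of_mem hδ0 hx.1 hx.2
  linarith

/-- The clamp `φ(x) = g(‖x‖)` and its derivative. -/
def clamp (R₀ R δ : ℝ) (x : (EuclideanSpace ℝ (Fin 3))) : ℝ := prof R₀ R δ ‖x‖

/-- The derivative of the clamp: `slope(‖x‖) • D‖·‖(x)` off the origin, `0` at the origin. -/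
def clampDeriv (R₀ R δ : ℝ) (x : (EuclideanSpace ℝ (Fin 3))) : (EuclideanSpace ℝ (Fin 3)) →L[ℝ] ℝ :=
  if x = 0 then 0 else (slope R₀ R δ ‖x‖) • fderiv ℝ (fun w : (EuclideanSpace ℝ (Fin 3)) => ‖w‖) x

/-- The clamp `x ↦ g(‖x‖)` is differentiable everywhere with derivative `clampDeriv` (it is constant near `0`). [folklore] -/
theorem clamp_hasFDerivAt {R₀ R δ : ℝ} (hR₀ : 0 < R₀) (hδ : 0 < δ) (x : (EuclideanSpace ℝ (Fin 3))) :
    HasFDerivAt (clamp R₀ R δ) (clampDeriv R₀ R δ x) x := by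
  by_cases hx : x = 0
  · subst hx
    rw [clampDeriv, if_pos rfl]
    have hev : (fun _ : (EuclideanSpace ℝ (Fin 3)) => (0 : ℝ)) =ᶠ[𝓝 (0 : (EuclideanSpace ℝ (Fin 3)))] clamp R₀ R δ := by
      filter_upwards [Metric.ball_mem_nhds (0 : (EuclideanSpace ℝ (Fin 3))) hR₀] with w hw
      rw [clamp, prof_eq_zero_of_le hR₀.le hδ]
      rw [mem_ball, dist_zero_right] at hw
      exact hw.le
    exact (hasFDerivAt_const (0 : ℝ) (0 : (EuclideanSpace ℝ (Fin 3)))).congr_of_eventuallyEq hev.symm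
  · rw [clampDeriv, if_neg hx]
    have hn : HasFDerivAt (fun w : (EuclideanSpace ℝ (Fin 3)) => ‖w‖) (fderiv ℝ (fun w : (EuclideanSpace ℝ (Fin 3)) => ‖w‖) x) x :=
      ((contDiffAt_norm ℝ hx (n := 1)).differentiableAt one_ne_zero).hasFDerivAt
    exact (prof_hasDerivAt R₀ R δ ‖x‖).comp_hasFDerivAt x hn

/-- `‖D clamp(x)‖ ≤ slope(‖x‖)` (the norm is `1`-Lipschitz). [folklore] -/
theorem norm_clampDeriv_le (R₀ R δ : ℝ) (x : (EuclideanSpace ℝ (Fin 3))) : ‖clampDeriv R₀ R δ x‖ ≤ slope R₀ R δ ‖x‖ := by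
  by_cases hx : x = 0
  · rw [clampDeriv, if_pos hx, norm_zero]; exact slope_nonneg _ _ _ _
  · rw [clampDeriv, if_neg hx, norm_smul, Real.norm_of_nonneg (slope_nonneg _ _ _ _)]
    have h1 : ‖fderiv ℝ (fun w : (EuclideanSpace ℝ (Fin 3)) => ‖w‖) x‖ ≤ 1 := by
      have := norm_fderiv_le_of_lipschitz ℝ (f := fun w : (EuclideanSpace ℝ (Fin 3)) => ‖w‖) (x₀ := x) lipschitzWith_one_norm
      simpa using this
    calc slope R₀ R δ ‖x‖ * ‖fderiv ℝ (fun w : (EuclideanSpace ℝ (Fin 3)) => ‖w‖) x‖ ≤ slope R₀ R δ ‖x‖ * 1 :=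
          mul_le_mul_of_nonneg_left h1 (slope_nonneg _ _ _ _)
      _ = slope R₀ R δ ‖x‖ := mul_one _

/-! ### U2: the per-label travel bound -/

/-- The clamp is continuous. [folklore] -/
theorem clamp_continuous (R₀ R δ : ℝ) : Continuous (clamp R₀ R δ) :=
  (prof_continuous R₀ R δ).comp continuous_norm

/-- Along a trajectory `σ ↦ X σ y` with velocity `u σ (X σ y)` (within `[t₁,t₀]`), the clamp can drop between `s` and `t₀` by at most
`∫_s^{t₀} slope(‖X σ y‖) ‖u σ (X σ y)‖ dσ`. -/
theorem label_bound {R₀ R δ : ℝ} (hR₀ : 0 < R₀) (hδ : 0 < δ) {u : ℝ → (EuclideanSpace ℝ (Fin 3)) → (EuclideanSpace ℝ (Fin 3))} {X : ℝ → (EuclideanSpace ℝ (Fin 3)) → (EuclideanSpace ℝ (Fin 3))}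
    {t₁ t₀ s : ℝ} {y : (EuclideanSpace ℝ (Fin 3))} (ht₀ : t₀ < 0) (hs : s ∈ Icc t₁ t₀)
    (hu : ContinuousOn (Function.uncurry u) (Iio (0 : ℝ) ×ˢ (univ : Set (EuclideanSpace ℝ (Fin 3)))))
    (hXc : Continuous (fun q : ℝ × (EuclideanSpace ℝ (Fin 3)) => X q.1 q.2))
    (hXd : ∀ r ∈ Icc t₁ t₀, HasDerivWithinAt (fun σ => X σ y) (u r (X r y)) (Icc t₁ t₀) r) :
    clamp R₀ R δ (X s y) - clamp R₀ R δ (X t₀ y) ≤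
      ∫ σ in s..t₀, slope R₀ R δ ‖X σ y‖ * ‖u σ (X σ y)‖ := by
  have ht₁t₀ : t₁ ≤ t₀ := hs.1.trans hs.2
  have hXy : Continuous fun σ : ℝ => X σ y := hXc.comp (continuous_id.prodMk continuous_const)
  set b : ℝ → ℝ := fun σ => slope R₀ R δ ‖X σ y‖ * ‖u σ (X σ y)‖ with hb
  have hbc : ContinuousOn b (Iio 0) := by
    have h1 : Continuous fun σ : ℝ => slope R₀ R δ ‖X σ y‖ :=
      (slope_continuous R₀ R δ).comp (continuous_norm.comp hXy)
    have h2 : ContinuousOn (fun σ : ℝ => u σ (X σ y)) (Iio 0) := by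
      have hmap : MapsTo (fun σ : ℝ => ((σ, X σ y) : ℝ × (EuclideanSpace ℝ (Fin 3)))) (Iio 0) (Iio (0 : ℝ) ×ˢ (univ : Set (EuclideanSpace ℝ (Fin 3)))) :=
        fun σ hσ => mk_mem_prod hσ (mem_univ _)
      exact hu.comp (continuous_id.prodMk hXy).continuousOn hmap
    exact h1.continuousOn.mul h2.norm
  set proj : ℝ → ℝ := fun σ => max t₁ (min t₀ σ) with hproj
  have hprojc : Continuous proj := continuous_const.max (continuous_const.min continuous_id)
  have hproj_mem : ∀ σ, proj σ ∈ Icc t₁ t₀ := fun σ =>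
    ⟨le_max_left _ _, max_le ht₁t₀ (min_le_left _ _)⟩
  have hproj_id : ∀ σ ∈ Icc t₁ t₀, proj σ = σ := fun σ hσ => by
    rw [hproj]; simp only; rw [min_eq_right hσ.2, max_eq_right hσ.1]
  set b'' : ℝ → ℝ := fun σ => b (proj σ) with hb''
  have hb''c : Continuous b'' :=
    hbc.comp_continuous hprojc fun σ => lt_of_le_of_lt (hproj_mem σ).2 ht₀
  set B : ℝ → ℝ := fun σ => ∫ x in s..σ, b'' x with hB
  have hBd : ∀ σ, HasDerivAt B (b'' σ) σ := fun σ => (hb''c.integral_hasStrictDerivAt s σ).hasDerivAt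
  set f : ℝ → ℝ := fun σ => clamp R₀ R δ (X σ y) - clamp R₀ R δ (X s y) with hf
  set f' : ℝ → ℝ := fun σ => clampDeriv R₀ R δ (X σ y) (u σ (X σ y)) with hf'
  have hfc : ContinuousOn f (Icc s t₀) :=
    (((clamp_continuous R₀ R δ).comp hXy).sub continuous_const).continuousOn
  have hfd : ∀ x ∈ Ico s t₀, HasDerivWithinAt f (f' x) (Ici x) x := by
    intro x hx
    have hx' : x ∈ Icc t₁ t₀ := ⟨hs.1.trans hx.1, hx.2.le⟩
    have h1 : HasDerivWithinAt (fun σ => clamp R₀ R δ (X σ y)) (clampDeriv R₀ R δ (X x y) (u x (X x y)))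
        (Icc t₁ t₀) x := by
      have := (clamp_hasFDerivAt (R := R) hR₀ hδ (X x y)).comp_hasDerivWithinAt x (hXd x hx')
      simpa [Function.comp_def] using this
    have h2 : HasDerivWithinAt f (f' x) (Icc t₁ t₀) x := by
      rw [hf, hf']; exact h1.sub_const _
    refine h2.mono_of_mem_nhdsWithin ?_
    exact mem_of_superset (Icc_mem_nhdsGE hx.2) (Icc_subset_Icc hx'.1 le_rfl)
  have hbound : ∀ x ∈ Ico s t₀, ‖f' x‖ ≤ b'' x := by
    intro x hx
    have hx' : x ∈ Icc t₁ t₀ := ⟨hs.1.trans hx.1, hx.2.le⟩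
    rw [hb'']; simp only; rw [hproj_id x hx', hb]; simp only; rw [hf']
    calc ‖clampDeriv R₀ R δ (X x y) (u x (X x y))‖ ≤ ‖clampDeriv R₀ R δ (X x y)‖ * ‖u x (X x y)‖ :=
          ContinuousLinearMap.le_opNorm _ _
      _ ≤ slope R₀ R δ ‖X x y‖ * ‖u x (X x y)‖ :=
          mul_le_mul_of_nonneg_right (norm_clampDeriv_le _ _ _ _) (norm_nonneg _)
  have ha : ‖f s‖ ≤ B s := by
    rw [hf, hB]; simp
  have key := image_norm_le_of_norm_deriv_right_le_deriv_boundary hfc hfd ha hBd hbound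
    (right_mem_Icc.2 hs.2)
  have hint : B t₀ = ∫ σ in s..t₀, b σ := by
    rw [hB]
    refine intervalIntegral.integral_congr fun σ hσ => ?_
    rw [uIcc_of_le hs.2] at hσ
    show b (proj σ) = b σ
    rw [hproj_id σ ⟨hs.1.trans hσ.1, hσ.2⟩]
  have hft₀ : f t₀ = clamp R₀ R δ (X t₀ y) - clamp R₀ R δ (X s y) := rfl
  rw [hft₀, hint, Real.norm_eq_abs] at key
  have := neg_le_of_abs_le key
  linarith

end K3

end Summit.NavierStokesRegularity.NavierStokesRegularity.Theorems.PowerGaugeEulerLiouville.ChiralAnchor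

end
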